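/-
Copyright (c) 2026. All rights reserved.
Released under Apache 2.0 license as described in the file LICENSE.
Authors: abc-iut cell, Cor. 3.12 sub-crew seat abc-iut-c312-1 (gen 27).
-/
import Mathlib.LinearAlgebra.PiTensorProduct.Basis
import Literature.IUT.LogVolume.TensorPacketTraceZeroDyadicSqrtNegOne
import Literature.IUT.LogVolume.TensorPacketOrbitContent
import Literature.IUT.LogVolume.TensorPacketHull
import HarnessLib

/-!
# On a tensor packet `⊗_{ℚ₂} K_b` of `n ≥ 2` factors all `≅ ℚ₂(√−1)`, EVERY principal `(R_I)^∼`-region `y·(R_I)^∼` lying in a scalar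
# multiple `c·log₂(R_I^×)` of the log-shell lattice is DEEP: all its components sit one shell below the top polyshell of `c·log₂(R_I^×)`
# (classical 2-adic algebra; the nontrivial idempotents of `(R_I)^∼` against the all-or-nothing top polyshell of
# `TensorPacketTraceZeroDyadicSqrtNegOne`)

abc-iut cell, PROOF-ONLY classical local algebra (Cor. 3.12 sub-crew, seat abc-iut-c312-1 gen 27, row «C:P2-PRIME-DICHOTOMY ⟹ STRICTNESS»,
file 1/2; no definition, no `Prop` fact, no instance, no notation).  Setting as in `TensorPacketTraceZeroDyadicSqrtNegOne` (gen 24): a finite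
family of `2`-adic fields `K_b` (`b ∈ I`) in the campaign-S class, each containing `i_b` with `i_b² = −1` and of invariants `(e, f) = (2, 1)`
(`K_b ≅ ℚ₂(√−1)`, `log₂(𝒪_{K_b}^×) = 𝔪_b³`), uniformizers `ϖ_b` (`ρ := ‖ϖ_b‖ = 2^{−1/2}`); the packet algebra `V = ⊗_{ℚ₂} K_b` (abc-iut-S6
`PacketAlgebra`), `(R_I)^∼` (`normalizedPacket`, [IUTchIV] Prop. 1.1), `log₂(R_I^×)` (`logPacket`), and ANY decomposition `ψ : V ≃ₐ Π_j L_j` into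
fields (abc-iut-S8).

WHY (the consumer, `Summits/ABC/IUTFork/Thm311RealInd1StripPrimeStrictnessDyadic`): gen 24's displayed equivalence
`Thm311RealInd1StripPacketHullDyadic.packetHull_eq_packetHull_smul_logPacket_iff` says that at an all-`ℚ₂(√−1)` packet the hull of print's
(Ind1)⊔(Ind2) orbit of a region `M ⊆ c·log₂(R_I^×)` equals the Dupuy–Hilado container hull IFF `M` itself reaches the container's top polyshell in
every component.  For the regions that actually occur — the Θ-regions `ι_j(t)·(R_I)^∼` of [IUTchIII] Cor. 3.12 Step (x) (Dupuy–Hilado §3.9), read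
against their OWN content container `2^{A}·log₂(R_I^×)` (abc-iut-s2 `exists_content`) — the right-hand side FAILS identically, for the following
classical reason proved here:

* §1 **`nontrivial_of_sq_eq_neg_one`** — with TWO factors `b₀ ≠ b₁` each containing a square root of `−1`, any decomposition has at least two
  components (`ι_{b₀}(i) ≠ ±ι_{b₁}(i)` by the tensor basis, while in a field two square roots of `−1` agree up to sign);
* §2 **`symm_single_one_mem_normalizedPacket`** — the primitive idempotents `e_j = ψ⁻¹(0,…,1_j,…,0)` lie in `(R_I)^∼` (idempotents are integral);
* §3 **`norm_psi_le_of_mem_smul_normalizedPacket_of_subset`** (ALWAYS DEEP) — if `y·(R_I)^∼ ⊆ c·log₂(R_I^×)` and the decomposition has two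
  components, then EVERY `x ∈ y·(R_I)^∼` has `‖ψ(x)_j‖ ≤ ‖c‖·ρ^{3n+1}` in EVERY component `j` (`n = #I`): `x·e_j ∈ y·(R_I)^∼ ⊆ c·log₂(R_I^×)`
  vanishes in a second component `j₁`, so by the packet congruence `norm_psi_sub_traceRatio_smul_le_of_mem_logPacket` (gen 24) its trace ratio
  has norm `≤ ρ` and its `j`-component — which is `ψ(x)_j` — is one shell down; consequences `hullRadius_image_smul_normalizedPacket_le` and
  **`not_forall_le_hullRadius_image_smul_normalizedPacket`** (for `c ≠ 0` the top polyshell `‖c‖·ρ^{3n}` is NOT reached — the negation of the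
  right-hand side of gen 24's iff), and the intrinsic forms over the chosen decomposition `dEquiv` (abc-iut-S8).
READING (classical; numbers about `ℚ₂(√−1)`-packets only): whereas a single factor `K ≅ ℚ₂(√−1)` has principal regions `g·𝒪 = 𝔪^m` reaching the
top of their content container for every odd `m`, at `n ≥ 2` factors NO principal `(R_I)^∼`-region ever does — the non-reduced structure of
`R_I = ⊗ ℤ₂[i]` inside `(R_I)^∼ = Π 𝒪_{L_j}` (hand check at `n = 2`: `R_I = {(a, b) : a ≡ b mod 2}`, content of `𝔪^m × 𝔪^m` is `⌊(m−8)/2⌋`, container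
polyradius `𝔪^{m−2}` or `𝔪^{m−3}`) keeps every such region at least one shell below.  HONEST SCOPE: classical; ALL factors of shape `(e, f) = (2, 1)`
with `√−1`, at least two of them; nothing here mentions a log-volume, a place of a number field or print's indeterminacies; no side taken on
[IUTchIII] Cor. 3.12; NO abc claim. [cite: NeukirchANT1999, Ch. II Prop. (5.5), (5.7)] [cite: SerreLocalFields1979, Ch. III §3, Prop. 7]
[cite: WeilBNT1967, Ch. II §2, Th. 2] [cite: Mochizuki2012, IUTchIV Prop. 1.1 p. 9, Prop. 1.2 (i) p. 10, Prop. 1.4 (i) p. 13] [claim: Mochizuki2012,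
status: disputed]
-/

set_option autoImplicit false

noncomputable section

open Metric Set Module Bornology
open scoped Pointwise TensorProduct

namespace Literature.IUT.LogVolume

namespace TraceZeroDyadicSqrtNegOne

open Literature.NumberTheory.GaloisRepresentations.Ultrametric RamificationCriterion

/-- An idempotent of an algebra is integral over the base: it is a root of the monic `X² − X`. [cite: SerreLocalFields1979, Ch. III §3, Prop. 7] -/
private theorem isIntegral_of_isIdempotentElem' {B E : Type} [CommRing B] [CommRing E] [Algebra B E] {z : E}
    (hz : IsIdempotentElem z) : IsIntegral B z := by
  nontriviality B
  refine ⟨Polynomial.X ^ 2 - Polynomial.X, ?_, ?_⟩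
  · exact (Polynomial.monic_X_pow 2).sub_of_left (by rw [Polynomial.degree_X_pow, Polynomial.degree_X]; norm_num)
  · simp [sq, hz.eq]

/-- `(1, i)` is `ℚ₂`-linearly independent as soon as `i ∉ ℚ₂·1` (twin of gen 24's private helper). [cite: NeukirchANT1999, Ch. II Prop. (5.5)] -/
private theorem linearIndependent_one_of_forall_algebraMap_ne' {K : Type} [NontriviallyNormedField K] [NormedAlgebra ℚ_[2] K] {i : K}
    (hi1 : ∀ a : ℚ_[2], algebraMap ℚ_[2] K a ≠ i) : LinearIndependent ℚ_[2] ![(1 : K), i] := by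
  refine LinearIndependent.pair_iff.mpr fun s t hst => ?_
  by_cases ht : t = 0
  · rw [ht, zero_smul, add_zero, Algebra.smul_def, mul_one] at hst
    exact ⟨(map_eq_zero_iff _ (algebraMap ℚ_[2] K).injective).mp hst, ht⟩
  · exfalso
    apply hi1 (-s / t)
    have h1 : t • i = -(s • (1 : K)) := eq_neg_of_add_eq_zero_right hst
    have h2 : i = t⁻¹ • (-(s • (1 : K))) := by
      rw [← h1, smul_smul, inv_mul_cancel₀ ht, one_smul]
    rw [h2, smul_neg, ← neg_smul, smul_smul, Algebra.smul_def, mul_one]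
    congr 1
    rw [div_eq_mul_inv, mul_comm, mul_neg, neg_mul]

/-! ## §1 Two factors with `√−1` force at least two components -/

section Packet

variable {I : Type} [Fintype I] [DecidableEq I]
variable (k : I → Type) [∀ b, NontriviallyNormedField (k b)] [∀ b, NormedAlgebra ℚ_[2] (k b)]
  [∀ b, IsUltrametricDist (k b)] [∀ b, ProperSpace (k b)]
variable {J : Type} (L : J → Type) [∀ j, NontriviallyNormedField (L j)] [∀ j, NormedAlgebra ℚ_[2] (L j)]
  [∀ j, IsUltrametricDist (L j)]
variable (ψ : PacketAlgebra 2 k ≃ₐ[ℚ_[2]] (Π j, L j))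
variable {ι : Π b, k b} (hι : ∀ b, ι b ^ 2 = -1) (he : ∀ b, absRamificationIdx 2 (k b) = 2) (hf : ∀ b, residueDegree 2 (k b) = 1)
  {ϖ : Π b, (k b)ˣ} (hϖ : ∀ b, IsUniformizer (ϖ b))

omit [∀ j, IsUltrametricDist (L j)] in
include ψ in
/-- The index set of a decomposition of `V ≠ 0` is nonempty. [cite: Mochizuki2012, IUTchIV Prop. 1.4 (i) p. 13] [claim: Mochizuki2012, status: disputed] -/
theorem nonempty_index : Nonempty J := by
  by_contra hJ
  rw [not_nonempty_iff] at hJ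
  have h1 : ψ 1 = ψ 0 := Subsingleton.elim _ _
  exact one_ne_zero (ψ.injective h1)

omit [∀ j, IsUltrametricDist (L j)] in
include ψ hι he hf in
/-- **TWO FACTORS CONTAINING `√−1` FORCE AT LEAST TWO COMPONENTS.**  If `b₀ ≠ b₁` then any decomposition `ψ : ⊗_{ℚ₂} K_b ≃ₐ Π_j L_j` into fields
has a nontrivial index set: in a field the two square roots `ψ(ι_{b₀}(i_{b₀}))_j`, `ψ(ι_{b₁}(i_{b₁}))_j` of `−1` agree up to sign, so a single
component would force `ι_{b₀}(i_{b₀}) = ±ι_{b₁}(i_{b₁})` in `V` — but in the tensor basis built from the bases `(1, i_b)` of the factors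
(`[K_b : ℚ₂] = e·f = 2`) the coordinate of `ι_{b₀}(i_{b₀})` at the index «`i` at `b₀`, `1` elsewhere» is `1` while that of `ι_{b₁}(i_{b₁})` is `0`.
[cite: NeukirchANT1999, Ch. II Prop. (5.5)] [cite: Mochizuki2012, IUTchIV Prop. 1.4 (i) p. 13] [claim: Mochizuki2012, status: disputed] -/
theorem nontrivial_of_sq_eq_neg_one {b₀ b₁ : I} (hb : b₀ ≠ b₁) : Nontrivial J := by
  classical
  obtain ⟨j₀⟩ := nonempty_index k L ψ
  by_contra hJ
  haveI : Subsingleton J := not_nontrivial_iff_subsingleton.mp hJ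
  -- the two square roots of `−1` in the field `L j₀`
  have hsq : ∀ (b : I), (ψ (iota 2 k b (ι b)) j₀) ^ 2 = -1 := fun b => by
    rw [← Pi.pow_apply, ← map_pow, ← map_pow, hι b, map_neg, map_one, map_neg, map_one, Pi.neg_apply, Pi.one_apply]
  have hpm : ψ (iota 2 k b₀ (ι b₀)) j₀ = ψ (iota 2 k b₁ (ι b₁)) j₀ ∨ ψ (iota 2 k b₀ (ι b₀)) j₀ = -ψ (iota 2 k b₁ (ι b₁)) j₀ :=
    sq_eq_sq_iff_eq_or_eq_neg.mp (by rw [hsq b₀, hsq b₁])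
  -- one component: equality in `V` up to sign
  have hV : iota 2 k b₀ (ι b₀) = iota 2 k b₁ (ι b₁) ∨ iota 2 k b₀ (ι b₀) = -iota 2 k b₁ (ι b₁) := by
    rcases hpm with h | h
    · refine Or.inl (ψ.injective (funext fun j => ?_))
      rw [Subsingleton.elim j j₀]; exact h
    · refine Or.inr (ψ.injective (funext fun j => ?_))
      rw [Subsingleton.elim j j₀, map_neg, Pi.neg_apply]; exact h
  -- the tensor basis from the bases `(1, i_b)`
  have hd : ∀ b, finrank ℚ_[2] (k b) = 2 := fun b => finrank_eq_two_of_invariants (he b) (hf b)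
  have hli : ∀ b, LinearIndependent ℚ_[2] ![(1 : k b), ι b] := fun b =>
    linearIndependent_one_of_forall_algebraMap_ne' (algebraMap_ne_of_sq_eq_neg_one (hι b))
  let β : ∀ b, Basis (Fin 2) ℚ_[2] (k b) := fun b =>
    basisOfLinearIndependentOfCardEqFinrank (hli b) (by rw [Fintype.card_fin, hd b])
  have hβ : ∀ b, ⇑(β b) = ![(1 : k b), ι b] := fun b => coe_basisOfLinearIndependentOfCardEqFinrank (hli b) _
  have hβ0 : ∀ b, β b 0 = 1 := fun b => by rw [hβ]; rfl
  have hβ1 : ∀ b, β b 1 = ι b := fun b => by rw [hβ]; rfl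
  have hdiag : ∀ b, (β b).repr (ι b) 1 = 1 := fun b => by rw [← hβ1 b, (β b).repr_self, Finsupp.single_eq_same]
  have hone0 : ∀ b, (β b).repr (1 : k b) 0 = 1 := fun b => by rw [← hβ0 b, (β b).repr_self, Finsupp.single_eq_same]
  have hone1 : ∀ b, (β b).repr (1 : k b) 1 = 0 := fun b => by
    rw [← hβ0 b, (β b).repr_self, Finsupp.single_apply, if_neg (show (0 : Fin 2) ≠ 1 by decide)]
  let B : Basis (Π b, Fin 2) ℚ_[2] (PacketAlgebra 2 k) := Basis.piTensorProduct β
  let J₀ : Π b, Fin 2 := fun b => if b = b₀ then 1 else 0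
  -- coordinates at `J₀`
  have hrepr : ∀ a : I, B.repr (iota 2 k a (ι a)) J₀ = ∏ b', (β b').repr (Pi.mulSingle a (ι a) b') (J₀ b') := fun a => by
    rw [iota_eq_purePacket, purePacket, Basis.piTensorProduct_repr_tprod_apply]
  have hu1 : B.repr (iota 2 k b₀ (ι b₀)) J₀ = 1 := by
    rw [hrepr b₀]
    refine Finset.prod_eq_one fun b' _ => ?_
    by_cases hb' : b' = b₀
    · subst hb'
      simp only [J₀, if_true, Pi.mulSingle_eq_same]
      exact hdiag _
    · simp only [J₀, if_neg hb', Pi.mulSingle_eq_of_ne hb']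
      exact hone0 _
  have hu'0 : B.repr (iota 2 k b₁ (ι b₁)) J₀ = 0 := by
    rw [hrepr b₁]
    refine Finset.prod_eq_zero (Finset.mem_univ b₀) ?_
    simp only [J₀, if_true, Pi.mulSingle_eq_of_ne hb]
    exact hone1 _
  rcases hV with h | h
  · have h' : B.repr (iota 2 k b₀ (ι b₀)) J₀ = B.repr (iota 2 k b₁ (ι b₁)) J₀ := by rw [h]
    rw [hu1, hu'0] at h'
    exact one_ne_zero h'
  · have h' : B.repr (iota 2 k b₀ (ι b₀)) J₀ = B.repr (-iota 2 k b₁ (ι b₁)) J₀ := by rw [h]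
    rw [map_neg, Finsupp.neg_apply, hu1, hu'0, neg_zero] at h'
    exact one_ne_zero h'

/-! ## §2 The primitive idempotents lie in `(R_I)^∼` -/

omit [∀ j, NormedAlgebra ℚ_[2] (L j)] [∀ j, IsUltrametricDist (L j)] in
/-- `(0,…,1_j,…,0)·(0,…,1_j,…,0) = (0,…,1_j,…,0)` in `Π_j L_j`. [cite: Mochizuki2012, IUTchIV Prop. 1.4 (i) p. 13] [claim: Mochizuki2012, status: disputed] -/
theorem single_one_mul_single_one [DecidableEq J] (j : J) :
    (Pi.single j (1 : L j) : Π j, L j) * Pi.single j (1 : L j) = Pi.single j 1 := by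
  ext j'
  rw [Pi.mul_apply]
  by_cases h : j' = j
  · subst h; rw [Pi.single_eq_same, mul_one]
  · rw [Pi.single_eq_of_ne h, mul_zero]

omit [Fintype I] [DecidableEq I] [∀ b, IsUltrametricDist (k b)] [∀ b, ProperSpace (k b)] [∀ j, IsUltrametricDist (L j)] in
/-- **The primitive idempotents `e_j = ψ⁻¹(0,…,1_j,…,0)` lie in `(R_I)^∼`** (an idempotent is integral over ANY subring, in particular over
`R_I`; `(R_I)^∼` is the integral closure of `R_I` in `V`, [IUTchIV] Prop. 1.1).  [cite: Mochizuki2012, IUTchIV Prop. 1.1 p. 9]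
[cite: SerreLocalFields1979, Ch. III §3, Prop. 7] [claim: Mochizuki2012, status: disputed] -/
theorem symm_single_one_mem_normalizedPacket [DecidableEq J] (j : J) :
    ψ.symm (Pi.single j 1) ∈ normalizedPacket 2 k := by
  have hid : IsIdempotentElem (ψ.symm (Pi.single j (1 : L j))) := by
    change ψ.symm (Pi.single j 1) * ψ.symm (Pi.single j 1) = ψ.symm (Pi.single j 1)
    rw [← map_mul, single_one_mul_single_one L j]
  change ψ.symm (Pi.single j 1) ∈ (integralClosure (integerPacket 2 k) (PacketAlgebra 2 k)).toSubring
  rw [Subalgebra.mem_toSubring, mem_integralClosure_iff]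
  exact isIntegral_of_isIdempotentElem' hid

omit [Fintype I] [DecidableEq I] [∀ b, IsUltrametricDist (k b)] [∀ b, ProperSpace (k b)] [∀ j, IsUltrametricDist (L j)] in
/-- Cutting a principal `(R_I)^∼`-region by an idempotent stays inside it: `x ∈ y·(R_I)^∼ ⟹ x·e_j ∈ y·(R_I)^∼`.
[cite: Mochizuki2012, IUTchIV Prop. 1.1 p. 9] [claim: Mochizuki2012, status: disputed] -/
theorem mul_symm_single_mem_smul_normalizedPacket [DecidableEq J] (j : J) {y x : PacketAlgebra 2 k}
    (hx : x ∈ y • (normalizedPacket 2 k : Set (PacketAlgebra 2 k))) :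
    x * ψ.symm (Pi.single j 1) ∈ y • (normalizedPacket 2 k : Set (PacketAlgebra 2 k)) := by
  obtain ⟨r, hr, rfl⟩ := Set.mem_smul_set.mp hx
  refine Set.mem_smul_set.mpr ⟨r * ψ.symm (Pi.single j 1), (normalizedPacket 2 k).mul_mem hr
    (symm_single_one_mem_normalizedPacket k L ψ j), ?_⟩
  rw [smul_eq_mul, smul_eq_mul, mul_assoc]

omit [Fintype I] [DecidableEq I] [∀ b, IsUltrametricDist (k b)] [∀ b, ProperSpace (k b)] [∀ j, IsUltrametricDist (L j)] in
/-- Components of `ψ(x·e_j)`: the `j`-th is `ψ(x)_j`, every other vanishes. [cite: Mochizuki2012, IUTchIV Prop. 1.4 (i) p. 13]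
[claim: Mochizuki2012, status: disputed] -/
theorem psi_mul_symm_single_apply [DecidableEq J] (j : J) (x : PacketAlgebra 2 k) (j' : J) :
    ψ (x * ψ.symm (Pi.single j 1)) j' = if j' = j then ψ x j' else 0 := by
  rw [map_mul, AlgEquiv.apply_symm_apply, Pi.mul_apply]
  by_cases h : j' = j
  · subst h; rw [Pi.single_eq_same, mul_one, if_pos rfl]
  · rw [Pi.single_eq_of_ne h, mul_zero, if_neg h]

/-! ## §3 ALWAYS DEEP: principal `(R_I)^∼`-regions inside `c·log₂(R_I^×)` stay one shell below its top polyshell -/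

include hι he hf hϖ in
/-- **ALWAYS DEEP.**  On a packet all of whose factors are `≅ ℚ₂(√−1)` and for a decomposition with at least two components: if a principal
`(R_I)^∼`-region `y·(R_I)^∼` (ANY `y ∈ V`) lies in `c·log₂(R_I^×)`, then EVERY `x ∈ y·(R_I)^∼` has `‖ψ(x)_j‖ ≤ ‖c‖·‖ϖ_{b₀}‖^{3n+1}` in EVERY
component — one shell below the top polyshell `‖c‖·‖ϖ‖^{3n}` of `c·log₂(R_I^×)` (`n = #I`).  Proof: `x·e_j ∈ y·(R_I)^∼ ⊆ c·log₂(R_I^×)` (§2) is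
`c·w` with `w ∈ log₂(R_I^×)` vanishing in a component `j₁ ≠ j`; gen 24's congruence `‖ψ(w)_{j'} − (Tr_V w/Θ)·ψ(π)_{j'}‖ ≤ ρ^{3n+1}` at `j₁` gives
`‖Tr_V w/Θ‖ ≤ ρ`, and at `j` then `‖ψ(w)_j‖ ≤ ρ^{3n+1}`. [cite: NeukirchANT1999, Ch. II Prop. (5.5), (5.7)] [cite: Mochizuki2012, IUTchIV Prop. 1.1
p. 9, Prop. 1.4 (i) p. 13] [claim: Mochizuki2012, status: disputed] -/
theorem norm_psi_le_of_mem_smul_normalizedPacket_of_subset [Nontrivial J] (b₀ : I) (c : ℚ_[2]) {y : PacketAlgebra 2 k}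
    (hy : y • (normalizedPacket 2 k : Set (PacketAlgebra 2 k)) ⊆ c • (logPacket 2 k : Set (PacketAlgebra 2 k)))
    {x : PacketAlgebra 2 k} (hx : x ∈ y • (normalizedPacket 2 k : Set (PacketAlgebra 2 k))) (j : J) :
    ‖ψ x j‖ ≤ ‖c‖ * ‖(ϖ b₀ : k b₀)‖ ^ (3 * Fintype.card I + 1) := by
  classical
  obtain ⟨j₁, hj₁⟩ := exists_ne j
  have hρ0 : 0 < ‖(ϖ b₀ : k b₀)‖ := norm_units_pos (ϖ b₀)
  -- `x·e_j = c·w`, `w ∈ log₂(R_I^×)`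
  have hxe : x * ψ.symm (Pi.single j 1) ∈ c • (logPacket 2 k : Set (PacketAlgebra 2 k)) :=
    hy (mul_symm_single_mem_smul_normalizedPacket k L ψ j hx)
  obtain ⟨w, hw, hcw⟩ := Set.mem_smul_set.mp hxe
  have hcomp : ∀ j', c • ψ w j' = if j' = j then ψ x j' else 0 := fun j' => by
    rw [← Pi.smul_apply, ← map_smul, hcw]; exact psi_mul_symm_single_apply k L ψ j x j'
  by_cases hc : c = 0
  · have h := hcomp j
    rw [hc, zero_smul, if_pos rfl] at h
    rw [← h, norm_zero]; positivity
  -- the packet congruence of gen 24 at `j₁` and at `j`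
  obtain ⟨hcong₁, -⟩ := norm_psi_sub_traceRatio_smul_le_of_mem_logPacket k L ψ hι he hf hϖ b₀ hw j₁
  obtain ⟨-, hπn₁⟩ := purePacket_pow_three_mem_logPacket_and_norm k L ψ hι he hf hϖ b₀ j₁
  obtain ⟨hcong, -⟩ := norm_psi_sub_traceRatio_smul_le_of_mem_logPacket k L ψ hι he hf hϖ b₀ hw j
  obtain ⟨-, hπn⟩ := purePacket_pow_three_mem_logPacket_and_norm k L ψ hι he hf hϖ b₀ j
  set π : PacketAlgebra 2 k := purePacket 2 k (fun b => (ϖ b : k b) ^ 3) with hπ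
  set t : ℚ_[2] := Algebra.trace ℚ_[2] (PacketAlgebra 2 k) w / Algebra.trace ℚ_[2] (PacketAlgebra 2 k) π with ht
  -- at `j₁`: `ψ(w)_{j₁} = 0`, so the trace ratio is small
  have hw₁ : ψ w j₁ = 0 := by
    have h := hcomp j₁
    rw [if_neg hj₁, smul_eq_zero] at h
    exact h.resolve_left hc
  rw [hw₁, zero_sub, norm_neg, norm_smul, hπn₁, pow_succ] at hcong₁
  have h1 : ‖t‖ * ‖(ϖ b₀ : k b₀)‖ ^ (3 * Fintype.card I) ≤ ‖(ϖ b₀ : k b₀)‖ * ‖(ϖ b₀ : k b₀)‖ ^ (3 * Fintype.card I) :=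
    calc ‖t‖ * ‖(ϖ b₀ : k b₀)‖ ^ (3 * Fintype.card I) ≤ ‖(ϖ b₀ : k b₀)‖ ^ (3 * Fintype.card I) * ‖(ϖ b₀ : k b₀)‖ := hcong₁
      _ = ‖(ϖ b₀ : k b₀)‖ * ‖(ϖ b₀ : k b₀)‖ ^ (3 * Fintype.card I) := mul_comm _ _
  have htn : ‖t‖ ≤ ‖(ϖ b₀ : k b₀)‖ := le_of_mul_le_mul_right h1 (pow_pos hρ0 _)
  -- at `j`: `ψ(w)_j` is one shell down
  have hwj : ‖ψ w j‖ ≤ ‖(ϖ b₀ : k b₀)‖ ^ (3 * Fintype.card I + 1) := by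
    have h := IsUltrametricDist.norm_add_le_max (ψ w j - t • ψ π j) (t • ψ π j)
    rw [sub_add_cancel] at h
    refine h.trans (max_le hcong ?_)
    rw [norm_smul, hπn, pow_succ]
    calc ‖t‖ * ‖(ϖ b₀ : k b₀)‖ ^ (3 * Fintype.card I) ≤ ‖(ϖ b₀ : k b₀)‖ * ‖(ϖ b₀ : k b₀)‖ ^ (3 * Fintype.card I) :=
          mul_le_mul_of_nonneg_right htn (pow_nonneg hρ0.le _)
      _ = ‖(ϖ b₀ : k b₀)‖ ^ (3 * Fintype.card I) * ‖(ϖ b₀ : k b₀)‖ := mul_comm _ _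
  have h := hcomp j
  rw [if_pos rfl] at h
  rw [← h, norm_smul]
  exact mul_le_mul_of_nonneg_left hwj (norm_nonneg c)

include hι he hf hϖ in
/-- **Two factors suffice**: with `b₀ ≠ b₁` (so at least two components, §1) every `x ∈ y·(R_I)^∼ ⊆ c·log₂(R_I^×)` has all components
`≤ ‖c‖·‖ϖ‖^{3n+1}`, for ANY decomposition `ψ`. [cite: NeukirchANT1999, Ch. II Prop. (5.5), (5.7)] [cite: Mochizuki2012, IUTchIV Prop. 1.4 (i) p. 13]
[claim: Mochizuki2012, status: disputed] -/
theorem norm_psi_le_of_mem_smul_normalizedPacket_of_subset_of_ne {b₀ b₁ : I} (hb : b₀ ≠ b₁) (c : ℚ_[2]) {y : PacketAlgebra 2 k}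
    (hy : y • (normalizedPacket 2 k : Set (PacketAlgebra 2 k)) ⊆ c • (logPacket 2 k : Set (PacketAlgebra 2 k)))
    {x : PacketAlgebra 2 k} (hx : x ∈ y • (normalizedPacket 2 k : Set (PacketAlgebra 2 k))) (j : J) :
    ‖ψ x j‖ ≤ ‖c‖ * ‖(ϖ b₀ : k b₀)‖ ^ (3 * Fintype.card I + 1) := by
  haveI : Nontrivial J := nontrivial_of_sq_eq_neg_one k L ψ hι he hf hb
  exact norm_psi_le_of_mem_smul_normalizedPacket_of_subset k L ψ hι he hf hϖ b₀ c hy hx j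

omit [DecidableEq I] [∀ b, NormedAlgebra ℚ_[2] (k b)] [∀ b, IsUltrametricDist (k b)] [∀ b, ProperSpace (k b)] in
include hϖ in
/-- `‖c‖·ρ^{3n+1} < ‖c‖·ρ^{3n}` for `c ≠ 0`. [cite: NeukirchANT1999, Ch. II Prop. (5.5)] -/
private theorem norm_mul_pow_succ_lt' (b₀ : I) {c : ℚ_[2]} (hc : c ≠ 0) :
    ‖c‖ * ‖(ϖ b₀ : k b₀)‖ ^ (3 * Fintype.card I + 1) < ‖c‖ * ‖(ϖ b₀ : k b₀)‖ ^ (3 * Fintype.card I) :=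
  mul_lt_mul_of_pos_left (pow_lt_pow_right_of_lt_one₀ (norm_units_pos (ϖ b₀)) (hϖ b₀).1 (by omega)) (norm_pos_iff.mpr hc)

include hι he hf hϖ in
/-- **The hull radii of a principal region are one shell down** (two factors `b₀ ≠ b₁`; `y·(R_I)^∼ ⊆ c·log₂(R_I^×)`): `hullRadius(ψ(y·(R_I)^∼))_j ≤
‖c‖·‖ϖ‖^{3n+1}` in every component. [cite: DupuyHilado2025, §4.12] [cite: NeukirchANT1999, Ch. II Prop. (5.5), (5.7)] [claim: Mochizuki2012, status: disputed] -/
theorem hullRadius_image_smul_normalizedPacket_le {b₀ b₁ : I} (hb : b₀ ≠ b₁) (c : ℚ_[2]) {y : PacketAlgebra 2 k}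
    (hy : y • (normalizedPacket 2 k : Set (PacketAlgebra 2 k)) ⊆ c • (logPacket 2 k : Set (PacketAlgebra 2 k))) (j : J) :
    hullRadius L (ψ '' (y • (normalizedPacket 2 k : Set (PacketAlgebra 2 k)))) j ≤ ‖c‖ * ‖(ϖ b₀ : k b₀)‖ ^ (3 * Fintype.card I + 1) := by
  refine hullRadius_le_of_nonneg L (by positivity) ?_
  rintro _ ⟨x, hx, rfl⟩
  exact norm_psi_le_of_mem_smul_normalizedPacket_of_subset_of_ne k L ψ hι he hf hϖ hb c hy hx j

include hι he hf hϖ in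
/-- **THE TOP POLYSHELL IS NEVER REACHED** (two factors `b₀ ≠ b₁`, `c ≠ 0`, `y·(R_I)^∼ ⊆ c·log₂(R_I^×)`): it is FALSE that
`‖c‖·‖ϖ‖^{3n} ≤ hullRadius(ψ(y·(R_I)^∼))_j` for all `j` — the right-hand side of gen 24's displayed equivalence
`Thm311RealInd1StripPacketHullDyadic.packetHull_eq_packetHull_smul_logPacket_iff` fails for EVERY principal region, whatever `y`.
[cite: DupuyHilado2025, §4.9, §4.12] [cite: NeukirchANT1999, Ch. II Prop. (5.5), (5.7)] [claim: Mochizuki2012, status: disputed] -/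
theorem not_forall_le_hullRadius_image_smul_normalizedPacket {b₀ b₁ : I} (hb : b₀ ≠ b₁) {c : ℚ_[2]} (hc : c ≠ 0) {y : PacketAlgebra 2 k}
    (hy : y • (normalizedPacket 2 k : Set (PacketAlgebra 2 k)) ⊆ c • (logPacket 2 k : Set (PacketAlgebra 2 k))) :
    ¬ ∀ j, ‖c‖ * ‖(ϖ b₀ : k b₀)‖ ^ (3 * Fintype.card I) ≤ hullRadius L (ψ '' (y • (normalizedPacket 2 k : Set (PacketAlgebra 2 k)))) j := by
  obtain ⟨j₀⟩ := nonempty_index k L ψ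
  intro h
  exact absurd ((h j₀).trans (hullRadius_image_smul_normalizedPacket_le k L ψ hι he hf hϖ hb c hy j₀))
    (not_le.mpr (norm_mul_pow_succ_lt' k hϖ b₀ hc))

/-! ## §4 Intrinsic forms (the chosen decomposition `dEquiv`) -/

include hι he hf in
/-- At least two components in the CHOSEN decomposition `dEquiv` (abc-iut-S8), for two factors `b₀ ≠ b₁` containing `√−1`.
[cite: Mochizuki2012, IUTchIV Prop. 1.4 (i) p. 13] [claim: Mochizuki2012, status: disputed] -/
theorem nontrivial_dIdx_of_sq_eq_neg_one {b₀ b₁ : I} (hb : b₀ ≠ b₁) : Nontrivial (DIdx 2 k) :=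
  nontrivial_of_sq_eq_neg_one k (DFac 2 k) (dEquiv 2 k) hι he hf hb

include hι he hf hϖ in
/-- **ALWAYS DEEP, intrinsic form**: two factors `b₀ ≠ b₁`, `y·(R_I)^∼ ⊆ c·log₂(R_I^×)` ⟹ every `x ∈ y·(R_I)^∼` has all `dEquiv`-components
`≤ ‖c‖·‖ϖ‖^{3n+1}`. [cite: NeukirchANT1999, Ch. II Prop. (5.5), (5.7)] [cite: Mochizuki2012, IUTchIV Prop. 1.4 (i) p. 13] [claim: Mochizuki2012, status: disputed] -/
theorem norm_dEquiv_le_of_mem_smul_normalizedPacket_of_subset {b₀ b₁ : I} (hb : b₀ ≠ b₁) (c : ℚ_[2]) {y : PacketAlgebra 2 k}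
    (hy : y • (normalizedPacket 2 k : Set (PacketAlgebra 2 k)) ⊆ c • (logPacket 2 k : Set (PacketAlgebra 2 k)))
    {x : PacketAlgebra 2 k} (hx : x ∈ y • (normalizedPacket 2 k : Set (PacketAlgebra 2 k))) (j : DIdx 2 k) :
    ‖dEquiv 2 k x j‖ ≤ ‖c‖ * ‖(ϖ b₀ : k b₀)‖ ^ (3 * Fintype.card I + 1) :=
  norm_psi_le_of_mem_smul_normalizedPacket_of_subset_of_ne k (DFac 2 k) (dEquiv 2 k) hι he hf hϖ hb c hy hx j

include hι he hf hϖ in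
/-- **THE Θ-REGION OF A CONTENT IS ALWAYS DEEP IN ITS CONTENT CONTAINER** (the form the place-section rows consume): for a principal region
`M = y·(R_I)^∼` on a packet of at least two `ℚ₂(√−1)`-factors and any `m` with `M ⊆ 2^m·log₂(R_I^×)` (e.g. ITS content, abc-iut-s2
`exists_content`), every `x ∈ M` has all `dEquiv`-components `≤ ‖2^m‖·‖ϖ‖^{3n+1}`, STRICTLY below the container's top `‖2^m‖·‖ϖ‖^{3n}`.
[cite: WeilBNT1967, Ch. II §2, Th. 2] [cite: DupuyHilado2025, §4.9, §4.12] [cite: NeukirchANT1999, Ch. II Prop. (5.5), (5.7)]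
[claim: Mochizuki2012, status: disputed] -/
theorem norm_dEquiv_lt_top_of_content {b₀ b₁ : I} (hb : b₀ ≠ b₁) {y : PacketAlgebra 2 k} {m : ℤ}
    (hm : y • (normalizedPacket 2 k : Set (PacketAlgebra 2 k)) ⊆ ((2 : ℚ_[2]) ^ m) • (logPacket 2 k : Set (PacketAlgebra 2 k)))
    {x : PacketAlgebra 2 k} (hx : x ∈ y • (normalizedPacket 2 k : Set (PacketAlgebra 2 k))) (j : DIdx 2 k) :
    ‖dEquiv 2 k x j‖ ≤ ‖(2 : ℚ_[2]) ^ m‖ * ‖(ϖ b₀ : k b₀)‖ ^ (3 * Fintype.card I + 1) ∧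
      ‖dEquiv 2 k x j‖ < ‖(2 : ℚ_[2]) ^ m‖ * ‖(ϖ b₀ : k b₀)‖ ^ (3 * Fintype.card I) := by
  have hle := norm_dEquiv_le_of_mem_smul_normalizedPacket_of_subset k hι he hf hϖ hb _ hm hx j
  exact ⟨hle, hle.trans_lt (norm_mul_pow_succ_lt' k hϖ b₀ (zpow_ne_zero m two_ne_zero))⟩

end Packet

end TraceZeroDyadicSqrtNegOne

end Literature.IUT.LogVolume

end
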